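import Summits.Langlands.Langlands.Theorems.IrreducibilityBySelfDualityIrreducibleOffSectorIotaTransport
import Mathlib.Analysis.Normed.Field.Approximation
import Mathlib.FieldTheory.PrimitiveElement
import Mathlib.Algebra.Algebra.Hom.Rat
import HarnessLib

/-!
# `IrreducibleOffSector`: the `∀ ι` of the crux for L-arithmetic `π` is "one `ι` per prime `λ ∣ ℓ`"
(crux stmt-Langlands-14329 `IrreducibilityBySelfDuality.IrreducibleOffSector`, line `Sketch`;
`--supports` file, STRUCTURAL: no import of the route module; continuation lead c5)

Sequel of `…IrreducibleOffSectorIotaTransport` (p123746), which proved: for `π` L-arithmetic over a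
subfield `E ⊆ ℂ` a.e., the crux's conclusion `C(ι)` (every `ρ` Satake–Frobenius compatible with
`(π, ι)` a.e. is irreducible) passes from `ι₁` to `ι₂` as soon as the embeddings
`ι₁⁻¹|_E, ι₂⁻¹|_E : E → ℚ̄_ℓ` differ by an element of `Gal(ℚ̄_ℓ/ℚ_ℓ)`.  This file supplies the
dictionary that makes that hypothesis CLASSICAL — two embeddings of a number field into `ℚ̄_ℓ`
inducing the same absolute value (i.e. the same prime `λ ∣ ℓ` with its normalised `λ`-adic absolute
value) are `Gal(ℚ̄_ℓ/ℚ_ℓ)`-conjugate — and draws the conclusion: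

* `norm_aeval_le_of_coeff_norm_le` — `‖h(a)‖ ≤ (d+1) δ max(‖a‖,1)^d` for `h ∈ ℚ_ℓ[X]` of degree
  `≤ d` with coefficients of norm `≤ δ`, `a ∈ ℚ̄_ℓ`;
* `aeval_minpoly_apply_eq_zero_of_norm_eq` — if `e₁, e₂ : E → ℚ̄_ℓ` induce the same absolute value
  on the number field `E` then `e₂ θ` is a root of `minpoly_{ℚ_ℓ}(e₁ θ)` for every `θ ∈ E`
  (approximate the `ℓ`-adic minimal polynomial by `G ∈ ℚ[X]`, Mathlib
  `Polynomial.exists_monic_and_natDegree_eq_and_norm_map_algebraMap_coeff_sub_lt` with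
  `Padic.denseRange_ratCast`; then `‖e₁ G(θ)‖` is small while `‖e₂ G(θ)‖` is not);
* `exists_algEquiv_apply_eq_of_norm_eq` — **same absolute value ⇒ `Gal(ℚ̄_ℓ/ℚ_ℓ)`-conjugate**
  (primitive element `θ` of `E/ℚ`, `minpoly.exists_algEquiv_of_root'` for the normal extension
  `ℚ̄_ℓ/ℚ_ℓ`, and two `ℚ`-algebra maps agreeing on `θ` agree on `ℚ(θ) = E`);
* `conclusion_of_conclusion_of_norm_eq` — for `π` L-arithmetic over `E` (finite over `ℚ`) a.e.:
  `C(ι₁) → C(ι₂)` whenever `‖ι₁⁻¹ x‖ = ‖ι₂⁻¹ x‖` for all `x ∈ E`, i.e. whenever `ι₁` and `ι₂` induce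
  the same prime `λ ∣ ℓ` of the Hecke field; binder shape
  `irreducibleOffSector_conclusion_of_isLArithmetic_of_norm_eq`.

Consequently, for L-arithmetic `π` (a theorem for regular algebraic `π`, Buzzard–Gee Conj. 3.1.6
in general) the uncountable quantifier `∀ ι : ℚ̄_ℓ ≃+* ℂ` of `IrreducibleOffSector` is exactly the
classical finite one, "for every prime `λ ∣ ℓ` of `E`".

References: J. Neukirch, *Algebraic Number Theory* (1999), Ch. II (8.1)–(8.3) (extensions of
valuations = embeddings modulo conjugacy); J.-P. Serre, *Local Fields*, Ch. II §2; K. Buzzard,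
T. Gee, LMS LNS 414 (2014), §2.1, Conj. 3.1.6, Conj. 3.2.1.
-/

noncomputable section

set_option linter.dupNamespace false

open scoped NumberField Classical Polynomial
open Filter IsDedekindDomain Polynomial
open Literature.NumberTheory.Automorphic Literature.NumberTheory.GaloisRepresentations
open Summit.Langlands

namespace Summit.Langlands.Langlands.Theorems.IrreducibleOffSector

/-! ## 1. Embeddings of a number field into `ℚ̄_ℓ` with the same absolute value are conjugate -/

section SamePlace

variable {ℓ : ℕ} [Fact ℓ.Prime]

/-- **Evaluation bound.**  For `h ∈ ℚ_ℓ[X]` with `natDegree h ≤ d` and all coefficients of norm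
`≤ δ` (`δ ≥ 0`), and `a ∈ ℚ̄_ℓ`: `‖h(a)‖ ≤ (d + 1) δ max(‖a‖, 1)^d` (triangle inequality on
`h(a) = Σ_{i ≤ d} h_i a^i`). [folklore] -/
theorem norm_aeval_le_of_coeff_norm_le {h : ℚ_[ℓ][X]} {d : ℕ} (hd : h.natDegree ≤ d) {δ : ℝ}
    (hc : ∀ i, ‖h.coeff i‖ ≤ δ) (a : PadicAlgCl ℓ) :
    ‖aeval a h‖ ≤ (d + 1) * δ * max ‖a‖ 1 ^ d := by
  have hδ : 0 ≤ δ := (norm_nonneg _).trans (hc 0)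
  rw [aeval_eq_sum_range' (Nat.lt_succ_of_le hd)]
  calc ‖∑ i ∈ Finset.range (d + 1), h.coeff i • a ^ i‖
      ≤ ∑ i ∈ Finset.range (d + 1), ‖h.coeff i • a ^ i‖ := norm_sum_le _ _
    _ ≤ ∑ _i ∈ Finset.range (d + 1), δ * max ‖a‖ 1 ^ d := by
        refine Finset.sum_le_sum fun i hi => ?_
        rw [norm_smul, norm_pow]
        refine mul_le_mul (hc i) ?_ (pow_nonneg (norm_nonneg a) i) hδ
        exact (pow_le_pow_left₀ (norm_nonneg a) (le_max_left _ _) i).trans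
          (pow_le_pow_right₀ (le_max_right _ _) (Nat.le_of_lt_succ (Finset.mem_range.1 hi)))
    _ = (d + 1) * δ * max ‖a‖ 1 ^ d := by
        rw [Finset.sum_const, Finset.card_range, nsmul_eq_mul, Nat.cast_add, Nat.cast_one, mul_assoc]

/-- A ring homomorphism out of a `ℚ`-algebra field commutes with evaluation of a RATIONAL polynomial,
read through `ℚ → ℚ_ℓ → ℚ̄_ℓ`: `G^{(ℚ_ℓ)}(e θ) = e(G(θ))`. [folklore] -/
theorem aeval_map_algebraMap_eq_apply_aeval {E : Type*} [Field E] [Algebra ℚ E]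
    (e : E →+* PadicAlgCl ℓ) (G : ℚ[X]) (θ : E) :
    aeval (e θ) (G.map (algebraMap ℚ ℚ_[ℓ])) = e (aeval θ G) := by
  rw [aeval_map_algebraMap, ← RingHom.toRatAlgHom_apply e θ, aeval_algHom_apply,
    RingHom.toRatAlgHom_apply]

/-- **Same absolute value ⇒ common `ℓ`-adic minimal polynomials.**  Let `E` be a number field and
`e₁, e₂ : E → ℚ̄_ℓ` ring homomorphisms inducing the same absolute value on `E`
(`‖e₁ x‖ = ‖e₂ x‖`).  Then for every `θ ∈ E`, `e₂ θ` is a root of the minimal polynomial `g` of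
`e₁ θ` over `ℚ_ℓ`.  Proof: if `c = ‖g(e₂ θ)‖ > 0`, approximate the monic `g ∈ ℚ_ℓ[X]` by a monic
`G ∈ ℚ[X]` of the same degree `d` with coefficients within `δ`, `(d+1) δ M^d < c/2`
(`M = max(‖e₁ θ‖, ‖e₂ θ‖, 1)`); then `‖e₁ G(θ)‖ = ‖(G - g)(e₁ θ)‖ < c/2` while
`‖e₂ G(θ)‖ ≥ ‖g(e₂ θ)‖ - ‖(G - g)(e₂ θ)‖ > c/2`, contradicting `‖e₁ G(θ)‖ = ‖e₂ G(θ)‖`.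
[cite: NeukirchANT1999, Ch. II (8.1)–(8.3)] -/
theorem aeval_minpoly_apply_eq_zero_of_norm_eq {E : Type*} [Field E] [Algebra ℚ E]
    (e₁ e₂ : E →+* PadicAlgCl ℓ) (hv : ∀ x : E, ‖e₁ x‖ = ‖e₂ x‖) (θ : E) :
    aeval (e₂ θ) (minpoly ℚ_[ℓ] (e₁ θ)) = 0 := by
  by_contra hne
  set y₁ : PadicAlgCl ℓ := e₁ θ with hy₁
  set y₂ : PadicAlgCl ℓ := e₂ θ with hy₂
  set g : ℚ_[ℓ][X] := minpoly ℚ_[ℓ] y₁ with hg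
  have hgm : g.Monic := minpoly.monic (Algebra.IsIntegral.isIntegral y₁)
  set c : ℝ := ‖aeval y₂ g‖ with hc
  have hc0 : 0 < c := norm_pos_iff.2 hne
  set d : ℕ := g.natDegree with hd
  set M : ℝ := max (max ‖y₁‖ ‖y₂‖) 1 with hM
  have hM1 : 1 ≤ M := le_max_right _ _
  have hM0 : 0 < M := lt_of_lt_of_le one_pos hM1
  have hMd : 0 < M ^ d := pow_pos hM0 d
  have hd1 : (0 : ℝ) < d + 1 := by positivity
  -- the tolerance
  set δ : ℝ := c / (4 * ((d + 1) * M ^ d)) with hδ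
  have hδ0 : 0 < δ := div_pos hc0 (by positivity)
  have hbound : (d + 1) * δ * M ^ d = c / 4 := by
    rw [hδ]; field_simp
  -- rational approximation of `g`
  have hdense : DenseRange (algebraMap ℚ ℚ_[ℓ]) := by
    convert Padic.denseRange_ratCast ℓ using 1
    funext q
    exact eq_ratCast _ q
  obtain ⟨G, hGm, hGdeg, hcoef⟩ :=
    Polynomial.exists_monic_and_natDegree_eq_and_norm_map_algebraMap_coeff_sub_lt hdense hgm hδ0
  set D : ℚ_[ℓ][X] := G.map (algebraMap ℚ ℚ_[ℓ]) - g with hD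
  have hDdeg : D.natDegree ≤ d := by
    refine (natDegree_sub_le _ _).trans (max_le ?_ le_rfl)
    rw [natDegree_map_eq_of_injective (algebraMap ℚ ℚ_[ℓ]).injective, ← hGdeg]
  have hDcoef : ∀ i, ‖D.coeff i‖ ≤ δ := fun i => by
    rw [hD, coeff_sub]
    exact (hcoef i).le
  -- evaluation bounds at `y₁`, `y₂`
  have hev : ∀ a : PadicAlgCl ℓ, ‖a‖ ≤ M → ‖aeval a D‖ ≤ c / 4 := by
    intro a ha
    refine (norm_aeval_le_of_coeff_norm_le hDdeg hDcoef a).trans ?_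
    rw [← hbound]
    have hmax : max ‖a‖ 1 ≤ M := max_le ha hM1
    exact mul_le_mul_of_nonneg_left (pow_le_pow_left₀ (le_trans zero_le_one (le_max_right _ _))
      hmax d) (by positivity)
  have hsplit : ∀ a : PadicAlgCl ℓ, aeval a (G.map (algebraMap ℚ ℚ_[ℓ])) = aeval a D + aeval a g := by
    intro a; rw [hD, map_sub, sub_add_cancel]
  -- `‖e₁ G(θ)‖ ≤ c/4`
  have h1 : ‖e₁ (aeval θ G)‖ ≤ c / 4 := by
    rw [← aeval_map_algebraMap_eq_apply_aeval, hsplit, ← hy₁, hg, minpoly.aeval, add_zero]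
    exact hev y₁ ((le_max_left _ _).trans (le_max_left _ _))
  -- `‖e₂ G(θ)‖ ≥ c - c/4`
  have h2 : c - c / 4 ≤ ‖e₂ (aeval θ G)‖ := by
    rw [← aeval_map_algebraMap_eq_apply_aeval, hsplit, ← hy₂]
    have hD2 : ‖aeval y₂ D‖ ≤ c / 4 := hev y₂ ((le_max_right _ _).trans (le_max_left _ _))
    have htri : ‖aeval y₂ g‖ - ‖aeval y₂ D‖ ≤ ‖aeval y₂ D + aeval y₂ g‖ := by
      have h' := norm_sub_le (aeval y₂ D + aeval y₂ g) (aeval y₂ D)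
      rw [add_sub_cancel_left] at h'
      linarith
    rw [← hc] at htri
    linarith
  have h12 := hv (aeval θ G)
  linarith

/-- **Embeddings with the same absolute value are `Gal(ℚ̄_ℓ/ℚ_ℓ)`-conjugate.**  Let `E` be a
number field and `e₁, e₂ : E → ℚ̄_ℓ` ring homomorphisms with `‖e₁ x‖ = ‖e₂ x‖` for all `x ∈ E`
(they induce the same prime `λ ∣ ℓ` of `E` together with its absolute value).  Then
`e₂ = u ∘ e₁` for some `u ∈ Gal(ℚ̄_ℓ/ℚ_ℓ)`: with a primitive element `θ` of `E/ℚ`, `e₂ θ` is a root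
of `minpoly_{ℚ_ℓ}(e₁ θ)` (`aeval_minpoly_apply_eq_zero_of_norm_eq`), so some `u` maps `e₁ θ` to
`e₂ θ` (`ℚ̄_ℓ/ℚ_ℓ` is normal, Mathlib `minpoly.exists_algEquiv_of_root'`), and the `ℚ`-algebra
maps `u ∘ e₁`, `e₂` agree on `ℚ(θ) = E`.  This is the classical dictionary "primes of `E` above
`ℓ` ↔ `Gal(ℚ̄_ℓ/ℚ_ℓ)`-orbits of embeddings `E → ℚ̄_ℓ`" (surjectivity half).
[cite: NeukirchANT1999, Ch. II (8.1)–(8.3)] -/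
theorem exists_algEquiv_apply_eq_of_norm_eq {E : Type*} [Field E] [NumberField E]
    (e₁ e₂ : E →+* PadicAlgCl ℓ) (hv : ∀ x : E, ‖e₁ x‖ = ‖e₂ x‖) :
    ∃ u : PadicAlgCl ℓ ≃ₐ[ℚ_[ℓ]] PadicAlgCl ℓ, ∀ x : E, e₂ x = u (e₁ x) := by
  obtain ⟨θ, hθ⟩ := Field.exists_primitive_element ℚ E
  obtain ⟨u, hu⟩ := minpoly.exists_algEquiv_of_root' (Algebra.IsAlgebraic.isAlgebraic (e₁ θ))
    (aeval_minpoly_apply_eq_zero_of_norm_eq e₁ e₂ hv θ)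
  refine ⟨u, fun x => ?_⟩
  -- the two `ℚ`-algebra maps `u ∘ e₁` and `e₂`
  let f₁ : E →ₐ[ℚ] PadicAlgCl ℓ := (u.toAlgHom.restrictScalars ℚ).comp e₁.toRatAlgHom
  let f₂ : E →ₐ[ℚ] PadicAlgCl ℓ := e₂.toRatAlgHom
  have hadj : Algebra.adjoin ℚ ({θ} : Set E) = ⊤ := by
    rw [← IntermediateField.adjoin_simple_toSubalgebra_of_isAlgebraic
      (Algebra.IsAlgebraic.isAlgebraic θ), hθ, IntermediateField.top_toSubalgebra]
  have heq : f₁ = f₂ := by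
    refine AlgHom.ext_of_adjoin_eq_top hadj fun z hz => ?_
    rw [Set.mem_singleton_iff] at hz
    subst hz
    change u (e₁ z) = e₂ z
    exact hu
  have hx := congrArg (fun f : E →ₐ[ℚ] PadicAlgCl ℓ => f x) heq
  change u (e₁ x) = e₂ x at hx
  exact hx.symm

/-- **Two `ι` inducing the same place of the Hecke field are `Gal(ℚ̄_ℓ/ℚ_ℓ)`-conjugate on it.**  For a
subfield `E ⊆ ℂ` finite over `ℚ` and `ι₁, ι₂ : ℚ̄_ℓ ≃+* ℂ` with `‖ι₁⁻¹ x‖ = ‖ι₂⁻¹ x‖` for all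
`x ∈ E`, there is `u ∈ Gal(ℚ̄_ℓ/ℚ_ℓ)` with `ι₂⁻¹ x = u (ι₁⁻¹ x)` on `E`.
[cite: NeukirchANT1999, Ch. II (8.1)–(8.3)] -/
theorem exists_algEquiv_symm_eq_of_norm_eq (ι₁ ι₂ : PadicAlgCl ℓ ≃+* ℂ) (E : Subfield ℂ)
    [FiniteDimensional ℚ E] (hv : ∀ x ∈ E, ‖ι₁.symm x‖ = ‖ι₂.symm x‖) :
    ∃ u : PadicAlgCl ℓ ≃ₐ[ℚ_[ℓ]] PadicAlgCl ℓ, ∀ x ∈ E, ι₂.symm x = u (ι₁.symm x) := by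
  haveI : NumberField E := NumberField.mk
  obtain ⟨u, hu⟩ := exists_algEquiv_apply_eq_of_norm_eq
    ((ι₁.symm : ℂ ≃+* PadicAlgCl ℓ).toRingHom.comp E.subtype)
    ((ι₂.symm : ℂ ≃+* PadicAlgCl ℓ).toRingHom.comp E.subtype) (fun x => hv x x.2)
  exact ⟨u, fun x hx => hu ⟨x, hx⟩⟩

end SamePlace

/-! ## 2. The crux's conclusion depends on `ι` only through the prime `λ ∣ ℓ` of the Hecke field -/

section Conclusion

variable {ℓ : ℕ} [Fact ℓ.Prime] {K : Type} [Field K] [NumberField K] {n : ℕ}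
  {hcpt : isCompact_glFiniteIntegralLevel n K}

/-- **Same prime of the Hecke field ⇒ same conclusion.**  Let `π` be L-arithmetic over a subfield
`E ⊆ ℂ` finite over `ℚ` at almost all places (`e_i(t_{π,v}) ∈ E`, `i ≤ n`), and let
`ι₁, ι₂ : ℚ̄_ℓ ≃+* ℂ` induce the same absolute value on `E` (`‖ι₁⁻¹ x‖ = ‖ι₂⁻¹ x‖`, i.e. the same
prime `λ ∣ ℓ` of `E`).  If every `ρ` Satake–Frobenius compatible with `(π, ι₁)` a.e. is irreducible,
so is every `ρ` compatible with `(π, ι₂)` a.e. (`exists_algEquiv_symm_eq_of_norm_eq` +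
`conclusion_of_conclusion_of_eqOn_algEquiv` of `…IotaTransport`).
[cite: BuzzardGeeLMS2014, Conj. 3.1.6 and Conj. 3.2.1] [cite: NeukirchANT1999, Ch. II (8.1)–(8.3)] -/
theorem conclusion_of_conclusion_of_norm_eq (ι₁ ι₂ : PadicAlgCl ℓ ≃+* ℂ) (E : Subfield ℂ)
    [FiniteDimensional ℚ E] (hv : ∀ x ∈ E, ‖ι₁.symm x‖ = ‖ι₂.symm x‖)
    (π : AutomorphicRepData (AutomorphyDatum.gl n K hcpt))
    (hE : ∀ᶠ v : HeightOneSpectrum (𝓞 K) in cofinite, ∀ α : Multiset ℂ, π.HasSatakeParamAt v α →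
      ∀ i ≤ n, α.esymm i ∈ E)
    (h : ∀ ρ : FramedGaloisRep K (PadicAlgCl ℓ) n,
      (∀ᶠ v : HeightOneSpectrum (𝓞 K) in cofinite, SatakeFrobCompatibleAt ι₁ π ρ v) →
        ρ.toGaloisRep.IsIrreducible)
    (ρ : FramedGaloisRep K (PadicAlgCl ℓ) n)
    (hρ : ∀ᶠ v : HeightOneSpectrum (𝓞 K) in cofinite, SatakeFrobCompatibleAt ι₂ π ρ v) :
    ρ.toGaloisRep.IsIrreducible := by
  obtain ⟨u, hu⟩ := exists_algEquiv_symm_eq_of_norm_eq ι₁ ι₂ E hv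
  exact conclusion_of_conclusion_of_eqOn_algEquiv ι₁ ι₂ E u hu π hE h ρ hρ

/-- **Representatives of the primes `λ ∣ ℓ` of the Hecke field suffice** for the crux's `∀ ι`,
for L-arithmetic `π`: if `S` is a set of isomorphisms `ℚ̄_ℓ ≃+* ℂ` such that every `ι` induces on
`E` the same absolute value as some `ι₁ ∈ S`, the conclusion at every `ι₁ ∈ S` gives it at every `ι`.
[cite: BuzzardGeeLMS2014, Conj. 3.2.1] [cite: NeukirchANT1999, Ch. II (8.1)–(8.3)] -/
theorem conclusion_forall_of_place_representatives (E : Subfield ℂ) [FiniteDimensional ℚ E]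
    (π : AutomorphicRepData (AutomorphyDatum.gl n K hcpt))
    (hE : ∀ᶠ v : HeightOneSpectrum (𝓞 K) in cofinite, ∀ α : Multiset ℂ, π.HasSatakeParamAt v α →
      ∀ i ≤ n, α.esymm i ∈ E)
    (S : Set (PadicAlgCl ℓ ≃+* ℂ))
    (hrep : ∀ ι : PadicAlgCl ℓ ≃+* ℂ, ∃ ι₁ ∈ S, ∀ x ∈ E, ‖ι₁.symm x‖ = ‖ι.symm x‖)
    (hS : ∀ ι₁ ∈ S, ∀ ρ : FramedGaloisRep K (PadicAlgCl ℓ) n,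
      (∀ᶠ v : HeightOneSpectrum (𝓞 K) in cofinite, SatakeFrobCompatibleAt ι₁ π ρ v) →
        ρ.toGaloisRep.IsIrreducible)
    (ι : PadicAlgCl ℓ ≃+* ℂ) (ρ : FramedGaloisRep K (PadicAlgCl ℓ) n)
    (hρ : ∀ᶠ v : HeightOneSpectrum (𝓞 K) in cofinite, SatakeFrobCompatibleAt ι π ρ v) :
    ρ.toGaloisRep.IsIrreducible := by
  obtain ⟨ι₁, hι₁, hv⟩ := hrep ι
  exact conclusion_of_conclusion_of_norm_eq ι₁ ι E hv π hE (hS ι₁ hι₁) ρ hρ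

end Conclusion

/-! ## 3. In the binder shape of the crux -/

/-- **For L-arithmetic `π` the crux's `∀ ι` is "for every prime `λ ∣ ℓ` of the Hecke field"**
(binder shape of `IrreducibleOffSector`): given `n, K, hcpt`, a cuspidal `π` L-arithmetic over a
subfield `E ⊆ ℂ` finite over `ℚ` at almost all places, `ℓ`, and a set `S` of isomorphisms
`ℚ̄_ℓ ≃+* ℂ` representing every absolute value `x ↦ ‖ι⁻¹ x‖` on `E` (i.e. every prime `λ ∣ ℓ` of `E`
that some `ι` induces), the conclusion of `IrreducibleOffSector` at every `ι₁ ∈ S` implies it at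
EVERY `ι`. [cite: BuzzardGeeLMS2014, Conj. 3.1.6 and Conj. 3.2.1] -/
theorem irreducibleOffSector_conclusion_of_isLArithmetic_of_norm_eq
    (n : ℕ) (K : Type) [Field K] [NumberField K] (hcpt : isCompact_glFiniteIntegralLevel n K)
    (π : CuspidalAutomorphicRepData n K hcpt) (E : Subfield ℂ) (hfd : FiniteDimensional ℚ E)
    (hE : ∀ᶠ v : HeightOneSpectrum (𝓞 K) in cofinite, ∀ α : Multiset ℂ, π.1.HasSatakeParamAt v α →
      ∀ i ≤ n, α.esymm i ∈ E)
    (ℓ : ℕ) [Fact ℓ.Prime] (S : Set (PadicAlgCl ℓ ≃+* ℂ))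
    (hrep : ∀ ι : PadicAlgCl ℓ ≃+* ℂ, ∃ ι₁ ∈ S, ∀ x ∈ E, ‖ι₁.symm x‖ = ‖ι.symm x‖)
    (hS : ∀ ι₁ ∈ S, ∀ ρ : FramedGaloisRep K (PadicAlgCl ℓ) n,
      (∀ᶠ v : HeightOneSpectrum (𝓞 K) in cofinite, SatakeFrobCompatibleAt ι₁ π.1 ρ v) →
        ρ.toGaloisRep.IsIrreducible) :
    ∀ (ι : PadicAlgCl ℓ ≃+* ℂ) (ρ : FramedGaloisRep K (PadicAlgCl ℓ) n),
      (∀ᶠ v : HeightOneSpectrum (𝓞 K) in cofinite, SatakeFrobCompatibleAt ι π.1 ρ v) →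
        ρ.toGaloisRep.IsIrreducible := by
  haveI := hfd
  exact fun ι ρ hρ => conclusion_forall_of_place_representatives E π.1 hE S hrep hS ι ρ hρ

end Summit.Langlands.Langlands.Theorems.IrreducibleOffSector

end
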